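import Mathlib.Data.Complex.Basic
import Mathlib.Data.Fintype.Powerset
import Mathlib.Data.Finset.Card
import HarnessLib

/-!
# Pratt's balanced tripartitioning tensors `T_k`

Topic `Computability/AlgebraicComplexity`; definition request `defn-tripartitionTensor` of route
`MatrixMultiplication/TripartitionBridge` (which inlines the term below and wants it named, with
`rfl`-compatibility).

K. Pratt, *A stronger connection between the asymptotic rank conjecture and the set cover
conjecture*, STOC 2024 (arXiv:2311.02774), Definition 1.4:

> `T_k := ∑_{S, T, U ∈ binom([3k], k), S ∪ T ∪ U = [3k]} X_S Y_T Z_U`.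

So `T_k` is the 3-tensor on the index type `binom([3k], k)` (here
`TripartitionIndex k = {A : Finset (Fin (3k)) // A.card = k}`) whose entry at `(S, T, U)` is `1`
if `S ∪ T ∪ U = [3k]` and `0` otherwise. Three `k`-subsets of a `3k`-set have union everything iff
they are pairwise disjoint (`TripartitionIndex.disjoint_iff_union_eq_univ`), and the route spells
the condition as pairwise disjointness; `tripartitionTensor K k` is *literally* the route's term
`fun S T U => if Disjoint S.1 T.1 ∧ Disjoint S.1 U.1 ∧ Disjoint T.1 U.1 then 1 else 0`
(`tripartitionTensor_def` is `rfl`), and `tripartitionTensor_apply_eq_ite_union` is Pratt's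
printed form. `T_1` "arose in work of Coppersmith and Winograd" (Pratt §1.2: over `ℂ` it is
isomorphic to the small Coppersmith–Winograd tensor `cw₂`); that isomorphism, tightness and
conciseness (Pratt Prop. 2.1), the realisation of `T_k` as a zeroing of `(cw₁)^{⊠3k}`, the bound
`R(T_k) ≤ 8^k/2` (`char ≠ 2`, Pratt §1.2) and the restriction `T_{k+l} ≤ T_k ⊠ T_l` are NOT in
this file (they are the lemma requests (i)–(v) of the definition item, to be proved in companion
files).

## References

* [Pratt2024SCC] K. Pratt, *A stronger connection between the asymptotic rank conjecture and the set
  cover conjecture*, Proc. 56th STOC (2024), 871–874, doi:10.1145/3618260.3649620,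
  arXiv:2311.02774 — Def. 1.4, Problem 1.3, §1.2.
-/

namespace Literature.Computability.AlgebraicComplexity

universe u

/-- The index type `binom([3k], k)` of `T_k`: `k`-element subsets of `Fin (3k)`. An `abbrev`, so
that `Fintype`/`DecidableEq` instances of the subtype are found. [cite: Pratt2024SCC, Def. 1.4] -/
abbrev TripartitionIndex (k : ℕ) : Type :=
  {A : Finset (Fin (3 * k)) // A.card = k}

namespace TripartitionIndex

/-- `|binom([3k], k)| = binom(3k, k)`. [folklore] -/
theorem card (k : ℕ) : Fintype.card (TripartitionIndex k) = (3 * k).choose k := by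
  rw [Fintype.card_subtype,
    show (Finset.univ.filter fun A : Finset (Fin (3 * k)) => A.card = k) =
      Finset.powersetCard k (Finset.univ : Finset (Fin (3 * k))) by
    ext A; simp [Finset.mem_powersetCard],
    Finset.card_powersetCard, Finset.card_univ, Fintype.card_fin]

/-- Three `k`-subsets of `[3k]` are pairwise disjoint iff their union is everything (Pratt's
support condition `S ∪ T ∪ U = [3k]` versus the route's pairwise-disjointness spelling).
[cite: Pratt2024SCC, Def. 1.4] -/
theorem disjoint_iff_union_eq_univ {k : ℕ} (S T U : TripartitionIndex k) :
    (Disjoint S.1 T.1 ∧ Disjoint S.1 U.1 ∧ Disjoint T.1 U.1) ↔ S.1 ∪ T.1 ∪ U.1 = Finset.univ := by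
  obtain ⟨S, hS⟩ := S
  obtain ⟨T, hT⟩ := T
  obtain ⟨U, hU⟩ := U
  simp only
  have huniv : (Finset.univ : Finset (Fin (3 * k))).card = 3 * k := by simp
  constructor
  · rintro ⟨hST, hSU, hTU⟩
    apply Finset.eq_univ_of_card
    rw [Finset.card_union_of_disjoint (Finset.disjoint_union_left.mpr ⟨hSU, hTU⟩),
      Finset.card_union_of_disjoint hST, hS, hT, hU, Fintype.card_fin]
    ring
  · intro h
    have h1 : (S ∪ T ∪ U).card = 3 * k := by rw [h, huniv]
    have h2 : (S ∪ T ∪ U).card ≤ (S ∪ T).card + U.card := Finset.card_union_le _ _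
    have h3 : (S ∪ T).card ≤ S.card + T.card := Finset.card_union_le _ _
    have hST : Disjoint S T := Finset.card_union_eq_card_add_card.mp (by omega)
    have hSTU : Disjoint (S ∪ T) U := Finset.card_union_eq_card_add_card.mp (by omega)
    rw [Finset.disjoint_union_left] at hSTU
    exact ⟨hST, hSTU.1, hSTU.2⟩

end TripartitionIndex

/-- **Pratt's balanced tripartitioning tensor** `T_k = ∑_{S ∪ T ∪ U = [3k]} X_S Y_T Z_U` over a
commutative semiring `K`, on the index type `TripartitionIndex k = binom([3k], k)`: entry `1` at
pairwise disjoint `(S, T, U)` (equivalently `S ∪ T ∪ U = [3k]`,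
`tripartitionTensor_apply_eq_ite_union`) and `0` elsewhere. This is verbatim the term inlined by
route `MatrixMultiplication/TripartitionBridge`. [cite: Pratt2024SCC, Def. 1.4] -/
def tripartitionTensor (K : Type u) [CommSemiring K] (k : ℕ) :
    TripartitionIndex k → TripartitionIndex k → TripartitionIndex k → K :=
  fun S T U => if Disjoint S.1 T.1 ∧ Disjoint S.1 U.1 ∧ Disjoint T.1 U.1 then (1 : K) else 0

section

variable (K : Type u) [CommSemiring K]

/-- Unfolding lemma (`rfl`): `tripartitionTensor K k` is the route's inlined term.
[cite: Pratt2024SCC, Def. 1.4] -/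
theorem tripartitionTensor_def (k : ℕ) :
    tripartitionTensor K k = fun S T U : {A : Finset (Fin (3 * k)) // A.card = k} =>
      if Disjoint S.1 T.1 ∧ Disjoint S.1 U.1 ∧ Disjoint T.1 U.1 then (1 : K) else 0 :=
  rfl

/-- Entries of `T_k` (pairwise-disjointness form). [cite: Pratt2024SCC, Def. 1.4] -/
theorem tripartitionTensor_apply (k : ℕ) (S T U : TripartitionIndex k) :
    tripartitionTensor K k S T U =
      if Disjoint S.1 T.1 ∧ Disjoint S.1 U.1 ∧ Disjoint T.1 U.1 then (1 : K) else 0 :=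
  rfl

/-- Entries of `T_k` in Pratt's printed form: `1` iff `S ∪ T ∪ U = [3k]`.
[cite: Pratt2024SCC, Def. 1.4] -/
theorem tripartitionTensor_apply_eq_ite_union (k : ℕ) (S T U : TripartitionIndex k) :
    tripartitionTensor K k S T U = if S.1 ∪ T.1 ∪ U.1 = Finset.univ then (1 : K) else 0 := by
  rw [tripartitionTensor_apply]
  exact if_congr (TripartitionIndex.disjoint_iff_union_eq_univ S T U) rfl rfl

/-- `T_k` is `1` on tripartitions. [cite: Pratt2024SCC, Def. 1.4] -/
theorem tripartitionTensor_apply_of_disjoint (k : ℕ) {S T U : TripartitionIndex k}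
    (hST : Disjoint S.1 T.1) (hSU : Disjoint S.1 U.1) (hTU : Disjoint T.1 U.1) :
    tripartitionTensor K k S T U = 1 := by
  simp [tripartitionTensor_apply, hST, hSU, hTU]

/-- `T_k` vanishes off the tripartitions. [cite: Pratt2024SCC, Def. 1.4] -/
theorem tripartitionTensor_apply_of_not (k : ℕ) {S T U : TripartitionIndex k}
    (h : ¬ (Disjoint S.1 T.1 ∧ Disjoint S.1 U.1 ∧ Disjoint T.1 U.1)) :
    tripartitionTensor K k S T U = 0 := by
  simp only [tripartitionTensor_apply, h, if_false]

/-- `T_k` is symmetric under swapping the first two tensor factors. [cite: Pratt2024SCC, Def. 1.4] -/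
theorem tripartitionTensor_swap₁₂ (k : ℕ) (S T U : TripartitionIndex k) :
    tripartitionTensor K k T S U = tripartitionTensor K k S T U := by
  simp only [tripartitionTensor_apply]
  refine if_congr ?_ rfl rfl
  constructor
  · rintro ⟨h1, h2, h3⟩; exact ⟨h1.symm, h3, h2⟩
  · rintro ⟨h1, h2, h3⟩; exact ⟨h1.symm, h3, h2⟩

/-- `T_k` is symmetric under swapping the last two tensor factors. [cite: Pratt2024SCC, Def. 1.4] -/
theorem tripartitionTensor_swap₂₃ (k : ℕ) (S T U : TripartitionIndex k) :
    tripartitionTensor K k S U T = tripartitionTensor K k S T U := by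
  simp only [tripartitionTensor_apply]
  refine if_congr ?_ rfl rfl
  constructor
  · rintro ⟨h1, h2, h3⟩; exact ⟨h2, h1, h3.symm⟩
  · rintro ⟨h1, h2, h3⟩; exact ⟨h2, h1, h3.symm⟩

/-- `T_0` is the `1 × 1 × 1` tensor with entry `1` (the empty tripartition of `[0]`).
[cite: Pratt2024SCC, Def. 1.4] -/
theorem tripartitionTensor_zero (S T U : TripartitionIndex 0) :
    tripartitionTensor K 0 S T U = 1 := by
  have h0 : ∀ A : TripartitionIndex 0, A.1 = ∅ := fun A => Finset.card_eq_zero.mp A.2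
  simp [tripartitionTensor_apply, h0 S, h0 T, h0 U]

end

end Literature.Computability.AlgebraicComplexity
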